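import Literature.Topology.FourManifolds.BandSumConcordance
import Literature.Topology.FourManifolds.ConcordanceTransitivity
import HarnessLib

/-!
# Concordance of connected sums: reduction to one factor at a time

Third file of the decomposition of the named fact
`Literature.Topology.FourManifolds.Knot.IsConnectedSum.isConcordant` (`BandSum.lean`: concordance
is a congruence for the connected sum `#` of oriented knots — Fox–Milnor (1966), §1: the knot
cobordism classes form an abelian group under `#`; Livingston (2005), Thm. 2.2), after
`BandSumConcordance.lean` (reduction to the *connected sum of concordances*
`Knot.exists_isConnectedSum_isConcordant` modulo Schubert's uniqueness
`Knot.IsConnectedSum.isIsotopic`, "isotopic knots are concordant" and transitivity of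
concordance) and `ConcordanceTransitivity.lean` (transitivity, proved:
`equivalence_isConcordant_holds`).

Here the connected sum of concordances is reduced further to its **one-sided** form, the
statement the geometric construction naturally proves (a copy of the fixed factor `K₂` carried
along a concordance of the first factor):

* `Literature.Topology.FourManifolds.Knot.exists_isConnectedSum_isConcordant_left` (named fact,
  statement only, D-0014): if `K₁ ~ K₁'` are concordant then, for every knot `K₂`, *some*
  connected sum `K₁ # K₂` is concordant to *some* connected sum `K₁' # K₂`;
* `Literature.Topology.FourManifolds.Knot.exists_isConnectedSum_isConcordant_right` — the same
  in the second factor — and the proved passage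
  `exists_isConnectedSum_isConcordant_right_of_left` from the left version and commutativity
  of `#` (`Knot.IsConnectedSum.comm`, named fact of `BandSum.lean`);
* `Literature.Topology.FourManifolds.Knot.exists_isConnectedSum_isConcordant_of_left_of_right`
  (proved): left + right + uniqueness of connected sums (`IsConnectedSum.isIsotopic`) +
  "isotopic knots are concordant" + transitivity ⟹ `exists_isConnectedSum_isConcordant`
  (chain `K₁ # K₂ ~ K₁' # K₂ ≅ K₁' # K₂ ~ K₁' # K₂'`, the middle isotopy between two witnesses
  of `K₁' # K₂` being Schubert's theorem);
* `Literature.Topology.FourManifolds.Knot.IsConnectedSum.isConcordant_of_left` (proved): the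
  congruence `IsConnectedSum.isConcordant` follows from the one-sided fact, commutativity and
  Schubert's uniqueness alone — "isotopic knots are concordant"
  (`Knot.IsConcordant.of_isIsotopic_holds`, `SliceRibbonConcordanceProofs.lean`) and the
  equivalence relation (`equivalence_isConcordant_holds`, `ConcordanceTransitivity.lean`) being
  theorems of the tree.

## References

* R. H. Fox, J. W. Milnor, *Singularities of 2-spheres in 4-space and cobordism of knots*,
  Osaka J. Math. 3 (1966), 257–267, §1. [FoxMilnor1966]
* C. Livingston, *A survey of classical knot concordance*, Handbook of Knot Theory (2005), §2.1,
  Thm. 2.2 (held: arXiv math/0307077, p. 3). [Livingston2005]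

## Design notes

* The one-sided facts quantify the witnesses existentially, exactly like
  `exists_isConnectedSum_isConcordant`; they are special cases of the printed statement
  (Fox–Milnor prove the congruence for both factors at once), not stronger.
* No statement of another file is modified; no `sorry`.
-/

noncomputable section

namespace Literature.Topology.FourManifolds

namespace Knot

/-- **Connected sum of a concordance with a fixed knot (first factor).** If `K₁ ~ K₁'` are
concordant then for every knot `K₂` some connected sum `K₁ # K₂` is concordant to some connected
sum `K₁' # K₂`: a small copy of `K₂` tied into `K₁` inside a thin tube of an arc of `K₁` is
carried along a tube of a vertical strip of the concordance annulus. The one-factor case of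
Fox–Milnor (1966), §1 (the cobordism class of `k₁ # k₂` depends only on the classes of `k₁`,
`k₂`); Livingston (2005), Thm. 2.2. Named fact (statement only). [cite: FoxMilnor1966, §1] -/
def exists_isConnectedSum_isConcordant_left : Prop :=
  ∀ {K₁ K₁' : Knot} (K₂ : Knot), K₁.IsConcordant K₁' →
    ∃ K K' : Knot, IsConnectedSum K₁ K₂ K ∧ IsConnectedSum K₁' K₂ K' ∧ K.IsConcordant K'

/-- **Connected sum of a fixed knot with a concordance (second factor).** If `K₂ ~ K₂'` are
concordant then for every knot `K₁` some connected sum `K₁ # K₂` is concordant to some connected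
sum `K₁ # K₂'`. Fox–Milnor (1966), §1; Livingston (2005), Thm. 2.2. Named fact (statement only;
it follows from the first-factor version and commutativity,
`exists_isConnectedSum_isConcordant_right_of_left`). [cite: FoxMilnor1966, §1] -/
def exists_isConnectedSum_isConcordant_right : Prop :=
  ∀ (K₁ : Knot) {K₂ K₂' : Knot}, K₂.IsConcordant K₂' →
    ∃ K K' : Knot, IsConnectedSum K₁ K₂ K ∧ IsConnectedSum K₁ K₂' K' ∧ K.IsConcordant K'

/-- The second-factor version follows from the first-factor version and commutativity of the
connected sum (`IsConnectedSum.comm`): a concordant pair of witnesses of `K₂ # K₁`, `K₂' # K₁`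
is a concordant pair of witnesses of `K₁ # K₂`, `K₁ # K₂'`. [folklore] -/
theorem exists_isConnectedSum_isConcordant_right_of_left
    (hleft : exists_isConnectedSum_isConcordant_left) (hcomm : IsConnectedSum.comm) :
    exists_isConnectedSum_isConcordant_right := by
  intro K₁ K₂ K₂' h
  obtain ⟨K, K', hK, hK', hc⟩ := hleft K₁ h
  exact ⟨K, K', hcomm hK, hcomm hK', hc⟩

/-- Conversely the first-factor version follows from the second-factor version and
commutativity. [folklore] -/
theorem exists_isConnectedSum_isConcordant_left_of_right
    (hright : exists_isConnectedSum_isConcordant_right) (hcomm : IsConnectedSum.comm) :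
    exists_isConnectedSum_isConcordant_left := by
  intro K₁ K₁' K₂ h
  obtain ⟨K, K', hK, hK', hc⟩ := hright K₂ h
  exact ⟨K, K', hcomm hK, hcomm hK', hc⟩

/-- **Both factors from one factor at a time.** The one-sided facts, uniqueness of connected
sums up to isotopy (`IsConnectedSum.isIsotopic`, Schubert 1949), "isotopic knots are
concordant" (`IsConcordant.of_isIsotopic`) and transitivity of concordance
(`equivalence_isConcordant`) imply the connected sum of concordances
`exists_isConnectedSum_isConcordant`: if `K₁ ~ K₁'` and `K₂ ~ K₂'`, chain
`K₁ # K₂ ~ K₁' # K₂` (first factor), `K₁' # K₂ ≅ K₁' # K₂` (two witnesses, Schubert) and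
`K₁' # K₂ ~ K₁' # K₂'` (second factor). Fox–Milnor (1966), §1. [cite: FoxMilnor1966, §1] -/
theorem exists_isConnectedSum_isConcordant_of_left_of_right
    (hleft : exists_isConnectedSum_isConcordant_left)
    (hright : exists_isConnectedSum_isConcordant_right) (huniq : IsConnectedSum.isIsotopic)
    (hiso : IsConcordant.of_isIsotopic) (hE : equivalence_isConcordant) :
    exists_isConnectedSum_isConcordant := by
  intro K₁ K₂ K₁' K₂' h₁ h₂
  obtain ⟨K, K', hK, hK', hc⟩ := hleft K₂ h₁
  obtain ⟨L, L', hL, hL', hc'⟩ := hright K₁' h₂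
  exact ⟨K, L', hK, hL', hE.trans hc (hE.trans (hiso (huniq hK' hL)) hc')⟩

/-- The connected sum of concordances from the first-factor version, commutativity and
Schubert's uniqueness, the remaining inputs being theorems of the tree
(`IsConcordant.of_isIsotopic_holds`, `equivalence_isConcordant_holds`). [cite: FoxMilnor1966, §1] -/
theorem exists_isConnectedSum_isConcordant_of_left
    (hleft : exists_isConnectedSum_isConcordant_left) (hcomm : IsConnectedSum.comm)
    (huniq : IsConnectedSum.isIsotopic) : exists_isConnectedSum_isConcordant :=
  exists_isConnectedSum_isConcordant_of_left_of_right hleft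
    (exists_isConnectedSum_isConcordant_right_of_left hleft hcomm) huniq
    IsConcordant.of_isIsotopic_holds equivalence_isConcordant_holds

/-- **Reduction of the Fox–Milnor congruence to one factor.** Concordance is a congruence for
the connected sum (`IsConnectedSum.isConcordant`), granted the one-sided connected sum of a
concordance with a fixed knot (`exists_isConnectedSum_isConcordant_left`), commutativity of `#`
(`IsConnectedSum.comm`) and uniqueness of `#` up to isotopy (`IsConnectedSum.isIsotopic`,
Schubert 1949); "isotopic knots are concordant" and "concordance is an equivalence relation"
are supplied by `IsConcordant.of_isIsotopic_holds` and `equivalence_isConcordant_holds`.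
Fox–Milnor (1966), §1; Livingston (2005), Thm. 2.2. [cite: FoxMilnor1966, §1] -/
theorem IsConnectedSum.isConcordant_of_left (hleft : exists_isConnectedSum_isConcordant_left)
    (hcomm : IsConnectedSum.comm) (huniq : IsConnectedSum.isIsotopic) :
    IsConnectedSum.isConcordant :=
  IsConnectedSum.isConcordant_of_exists (exists_isConnectedSum_isConcordant_of_left hleft hcomm huniq)
    huniq IsConcordant.of_isIsotopic_holds equivalence_isConcordant_holds

end Knot

end Literature.Topology.FourManifolds
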